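import Summits.Ventures.PercRepro.RankLevelSetUsersLemma
import Summits.Ventures.PercRepro.RankLevelSetLineFreePlane

/-!
# PercRepro — THE LINE-FREE USERS BOUND: two and three users of a side (p9, gen 28)

In the vocabulary of RankLevelSetUsersLemma: `y ∈ G ∖ H` is a USER of the `G`-closed side `H` when `H` is a side of a
cover of `y` (a `G`-closed `K` with `y ∉ K` and `G ∖ {y} ⊆ H ∪ K`).  In the LINE-FREE `e`-free core (every 3-point
subset independent) a set of rank `≤ 3` has `≤ 5` points (RankLevelSetLineFreePlane), so the users lemma sharpens:
* TWO users `y ≠ y'` leave `(G ∖ H) ∖ {y, y'}` inside the rank-`≤ 3` set `K ∩ K'`: `|G| ≤ |H| + 7`;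
* THREE users `y₀, y₁, y₂` give the two rank-`≤ 3` sets `A = K₀ ∩ K₁ ∋ y₂` and `B = K₀ ∩ K₂ ∋ y₁`, both containing
  `S = (G ∖ H) ∖ {y₀, y₁, y₂}`, with `(G ∖ H) ∖ {y₀} ⊆ A ∪ B`.  If `r(S) ≤ 2` then `|S| ≤ 2` and `|G ∖ H| ≤ 5`; otherwise
  `r(S) ≥ 3`, submodularity `r(A ∩ B) + r(A ∪ B) ≤ r(A) + r(B) ≤ 6` gives `r(A ∪ B) ≤ 3`, so `(G ∖ H) ∖ {y₀}` has
  `≤ 5` points and `|G ∖ H| ≤ 6`.  Either way `|G| ≤ |H| + 6`.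
Consequences at `n = 15` (the line-free `(5, 15)` instance of the `f(5)` census, proofs/P9-FLATBOUND-g25.md §8 (b)):
a side of `≤ 7` points has ONE user, a side of `≤ 8` points has at most TWO — «an 8-point side serves at most one
point besides `0`», the counting step of the plane-cover filter, now theorem-backed beside its rank step
(RankLevelSetSideCover `side_cover_of_not_user`, RankLevelSetUsersLemma).

* **`ncard_le_ncard_add_seven_of_two_users_of_lineFree`** — two users: `|G| ≤ |H| + 7`;
* **`eq_of_users_of_ncard_le_seven_of_lineFree`** — a `≤ 7`-point side of a `≥ 15`-point set has one user;
* **`sdiff_singleton_subset_union_of_three_users`** — `(G ∖ H) ∖ {y₀} ⊆ (K₀ ∩ K₁) ∪ (K₀ ∩ K₂)`;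
* **`ncard_le_ncard_add_six_of_three_users_of_lineFree`** — three users: `|G| ≤ |H| + 6`;
* **`eq_or_eq_or_eq_of_three_users_of_ncard_le_eight_of_lineFree`** — a `≤ 8`-point side of a `≥ 15`-point set has
  at most two users (two of any three coincide).
Axioms: standard.  Nothing here moves a window; NO window claim (p9 owns S4).
-/

open scoped Matroid

namespace PercRepro

namespace ThmN

open Set

variable {α : Type}

/-- **Two users, line-free**: in the line-free `e`-free core with `r(G) ≤ 5`, two distinct users `y ≠ y'` of the side
`H ⊆ G` give `|G| ≤ |H| + 7` (the other `≤ 5` points form a set of rank `≤ 3`). -/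
theorem ncard_le_ncard_add_seven_of_two_users_of_lineFree (M : Matroid α) [M.Finite]
    (hfree : ∀ e ∈ M.E, ∃ A ⊆ M.E \ {e}, e ∉ M.closure A ∧ e ∉ M.closure ((M.E \ {e}) \ A))
    (hlf : ∀ T ⊆ M.E, T.ncard = 3 → M.Indep T)
    {G H K K' : Set α} {y y' : α} (hG : G ⊆ M.E) (hH : H ⊆ G) (hK : GClosed M G K)
    (hK' : GClosed M G K') (hy : y ∈ G) (hy' : y' ∈ G) (hyH : y ∉ H) (hy'H : y' ∉ H) (hne : y ≠ y')
    (hyK : y ∉ K) (hy'K' : y' ∉ K') (hcov : G \ {y} ⊆ H ∪ K) (hcov' : G \ {y'} ⊆ H ∪ K')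
    (hr : M.eRk G ≤ 5) : G.ncard ≤ H.ncard + 7 := by
  have hGfin : G.Finite := M.ground_finite.subset hG
  have hS : M.eRk ((G \ H) \ {y, y'}) + 2 ≤ M.eRk G :=
    eRk_sdiff_add_two_le_of_two_users M hG hK hK' hy hy' hyH hne hyK hy'K' hcov hcov'
  have hS3 : M.eRk ((G \ H) \ {y, y'}) ≤ 3 := by
    have h : M.eRk ((G \ H) \ {y, y'}) + 2 ≤ 3 + 2 := by
      calc M.eRk ((G \ H) \ {y, y'}) + 2 ≤ M.eRk G := hS
        _ ≤ 5 := hr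
        _ = 3 + 2 := by norm_num
    exact (ENat.add_le_add_iff_right (by norm_num : (2 : ℕ∞) ≠ ⊤)).1 h
  have hS5 : ((G \ H) \ {y, y'}).ncard ≤ 5 :=
    ncard_le_five_of_eRk_le_three_of_lineFree M hfree hlf
      ((Set.sdiff_subset.trans Set.sdiff_subset).trans hG) hS3
  have hpair : ({y, y'} : Set α) ⊆ G \ H := by
    intro z hz
    rcases hz with rfl | hz
    · exact ⟨hy, hyH⟩
    · rw [Set.mem_singleton_iff] at hz
      subst hz
      exact ⟨hy', hy'H⟩
  have h1 : ((G \ H) \ {y, y'}).ncard + ({y, y'} : Set α).ncard = (G \ H).ncard :=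
    Set.ncard_sdiff_add_ncard_of_subset hpair (hGfin.subset Set.sdiff_subset)
  have h2 : (G \ H).ncard + H.ncard = G.ncard := Set.ncard_sdiff_add_ncard_of_subset hH hGfin
  rw [Set.ncard_pair hne] at h1
  omega

/-- **A `≤ 7`-point side of a `≥ 15`-point set has one user** (line-free `e`-free core, rank `≤ 5`): `y = y'`. -/
theorem eq_of_users_of_ncard_le_seven_of_lineFree (M : Matroid α) [M.Finite]
    (hfree : ∀ e ∈ M.E, ∃ A ⊆ M.E \ {e}, e ∉ M.closure A ∧ e ∉ M.closure ((M.E \ {e}) \ A))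
    (hlf : ∀ T ⊆ M.E, T.ncard = 3 → M.Indep T)
    {G H K K' : Set α} {y y' : α} (hG : G ⊆ M.E) (hH : H ⊆ G) (hK : GClosed M G K)
    (hK' : GClosed M G K') (hy : y ∈ G) (hy' : y' ∈ G) (hyH : y ∉ H) (hy'H : y' ∉ H)
    (hyK : y ∉ K) (hy'K' : y' ∉ K') (hcov : G \ {y} ⊆ H ∪ K) (hcov' : G \ {y'} ⊆ H ∪ K')
    (hr : M.eRk G ≤ 5) (hG15 : 15 ≤ G.ncard) (hH7 : H.ncard ≤ 7) : y = y' := by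
  by_contra hne
  have := ncard_le_ncard_add_seven_of_two_users_of_lineFree M hfree hlf hG hH hK hK' hy hy' hyH hy'H
    hne hyK hy'K' hcov hcov' hr
  omega

/-- **Three users**: the points of `G ∖ H` other than `y₀` lie in `(K₀ ∩ K₁) ∪ (K₀ ∩ K₂)` — `y₁` in the second
set, every other point in the first. -/
theorem sdiff_singleton_subset_union_of_three_users {G H K₀ K₁ K₂ : Set α} {y₀ y₁ y₂ : α}
    (hy₁ : y₁ ∈ G) (hy₁H : y₁ ∉ H) (h01 : y₀ ≠ y₁) (h12 : y₁ ≠ y₂)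
    (hcov₀ : G \ {y₀} ⊆ H ∪ K₀) (hcov₁ : G \ {y₁} ⊆ H ∪ K₁) (hcov₂ : G \ {y₂} ⊆ H ∪ K₂) :
    (G \ H) \ {y₀} ⊆ (K₀ ∩ K₁) ∪ (K₀ ∩ K₂) := by
  intro z hz
  have hzy₀ : z ≠ y₀ := fun h => hz.2 (Set.mem_singleton_iff.2 h)
  by_cases hzy₁ : z = y₁
  · rw [hzy₁]
    exact Or.inr ⟨mem_side_of_cover hy₁ hy₁H h01.symm hcov₀, mem_side_of_cover hy₁ hy₁H h12 hcov₂⟩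
  · exact Or.inl ⟨mem_side_of_cover hz.1.1 hz.1.2 hzy₀ hcov₀, mem_side_of_cover hz.1.1 hz.1.2 hzy₁ hcov₁⟩

/-- **Three users, line-free**: in the line-free `e`-free core with `r(G) ≤ 5`, three distinct users `y₀, y₁, y₂` of
the side `H ⊆ G` (other sides `K₀, K₁, K₂`) give `|G| ≤ |H| + 6`. -/
theorem ncard_le_ncard_add_six_of_three_users_of_lineFree (M : Matroid α) [M.Finite]
    (hfree : ∀ e ∈ M.E, ∃ A ⊆ M.E \ {e}, e ∉ M.closure A ∧ e ∉ M.closure ((M.E \ {e}) \ A))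
    (hlf : ∀ T ⊆ M.E, T.ncard = 3 → M.Indep T)
    {G H K₀ K₁ K₂ : Set α} {y₀ y₁ y₂ : α} (hG : G ⊆ M.E) (hH : H ⊆ G)
    (hK₀ : GClosed M G K₀) (hK₁ : GClosed M G K₁) (hK₂ : GClosed M G K₂)
    (hy₀ : y₀ ∈ G) (hy₁ : y₁ ∈ G) (hy₂ : y₂ ∈ G) (hy₀H : y₀ ∉ H) (hy₁H : y₁ ∉ H) (hy₂H : y₂ ∉ H)
    (h01 : y₀ ≠ y₁) (h02 : y₀ ≠ y₂) (h12 : y₁ ≠ y₂)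
    (hy₀K₀ : y₀ ∉ K₀) (hy₁K₁ : y₁ ∉ K₁) (hy₂K₂ : y₂ ∉ K₂)
    (hcov₀ : G \ {y₀} ⊆ H ∪ K₀) (hcov₁ : G \ {y₁} ⊆ H ∪ K₁) (hcov₂ : G \ {y₂} ⊆ H ∪ K₂)
    (hr : M.eRk G ≤ 5) : G.ncard ≤ H.ncard + 6 := by
  have hGfin : G.Finite := M.ground_finite.subset hG
  have hGHfin : (G \ H).Finite := hGfin.subset Set.sdiff_subset
  have hGHE : G \ H ⊆ M.E := Set.sdiff_subset.trans hG
  -- the two rank-`≤ 3` sets `A = K₀ ∩ K₁` and `B = K₀ ∩ K₂`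
  have hy₀K₁ : y₀ ∈ K₁ := mem_side_of_cover hy₀ hy₀H h01 hcov₁
  have hy₀K₂ : y₀ ∈ K₂ := mem_side_of_cover hy₀ hy₀H h02 hcov₂
  have hA : M.eRk (K₀ ∩ K₁) + 2 ≤ M.eRk G :=
    eRk_inter_add_two_le_of_two_users M hG hK₀ hK₁ hy₀ hy₁ hy₀K₀ hy₀K₁ hy₁K₁
  have hB : M.eRk (K₀ ∩ K₂) + 2 ≤ M.eRk G :=
    eRk_inter_add_two_le_of_two_users M hG hK₀ hK₂ hy₀ hy₂ hy₀K₀ hy₀K₂ hy₂K₂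
  have hA3 : M.eRk (K₀ ∩ K₁) ≤ 3 := by
    have h : M.eRk (K₀ ∩ K₁) + 2 ≤ 3 + 2 := hA.trans (hr.trans (by norm_num))
    exact (ENat.add_le_add_iff_right (by norm_num : (2 : ℕ∞) ≠ ⊤)).1 h
  have hB3 : M.eRk (K₀ ∩ K₂) ≤ 3 := by
    have h : M.eRk (K₀ ∩ K₂) + 2 ≤ 3 + 2 := hB.trans (hr.trans (by norm_num))
    exact (ENat.add_le_add_iff_right (by norm_num : (2 : ℕ∞) ≠ ⊤)).1 h
  -- the other points `S = (G ∖ H) ∖ {y₀, y₁, y₂}` lie in `A ∩ B`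
  have h01sub : ({y₀, y₁} : Set α) ⊆ {y₀, y₁, y₂} := by
    intro z hz
    simp only [Set.mem_insert_iff, Set.mem_singleton_iff] at hz ⊢
    tauto
  have h02sub : ({y₀, y₂} : Set α) ⊆ {y₀, y₁, y₂} := by
    intro z hz
    simp only [Set.mem_insert_iff, Set.mem_singleton_iff] at hz ⊢
    tauto
  have hSA : (G \ H) \ {y₀, y₁, y₂} ⊆ K₀ ∩ K₁ :=
    (Set.sdiff_subset_sdiff_right h01sub).trans (sdiff_subset_inter_of_two_users hcov₀ hcov₁)
  have hSB : (G \ H) \ {y₀, y₁, y₂} ⊆ K₀ ∩ K₂ :=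
    (Set.sdiff_subset_sdiff_right h02sub).trans (sdiff_subset_inter_of_two_users hcov₀ hcov₂)
  -- the counts: `|G ∖ H| = |S| + 3` and `|G ∖ H| = |(G ∖ H) ∖ {y₀}| + 1`
  have htriple : ({y₀, y₁, y₂} : Set α) ⊆ G \ H := by
    intro z hz
    simp only [Set.mem_insert_iff, Set.mem_singleton_iff] at hz
    rcases hz with rfl | rfl | rfl
    · exact ⟨hy₀, hy₀H⟩
    · exact ⟨hy₁, hy₁H⟩
    · exact ⟨hy₂, hy₂H⟩
  have hcard3 : ({y₀, y₁, y₂} : Set α).ncard = 3 := by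
    rw [Set.ncard_insert_of_notMem (by simp [h01, h02]), Set.ncard_pair h12]
  have hS3 : ((G \ H) \ {y₀, y₁, y₂}).ncard + 3 = (G \ H).ncard := by
    rw [← hcard3]
    exact Set.ncard_sdiff_add_ncard_of_subset htriple hGHfin
  have hT1 : ((G \ H) \ {y₀}).ncard + 1 = (G \ H).ncard :=
    Set.ncard_sdiff_singleton_add_one ⟨hy₀, hy₀H⟩ hGHfin
  have h2 : (G \ H).ncard + H.ncard = G.ncard := Set.ncard_sdiff_add_ncard_of_subset hH hGfin
  -- the dichotomy on the rank of `S`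
  by_cases hrS : M.eRk ((G \ H) \ {y₀, y₁, y₂}) ≤ 2
  · have hS2 : ((G \ H) \ {y₀, y₁, y₂}).ncard ≤ 2 :=
      ncard_le_two_of_eRk_le_two_of_lineFree M hlf (Set.sdiff_subset.trans hGHE) hrS
    omega
  · have hrS3 : (3 : ℕ∞) ≤ M.eRk ((G \ H) \ {y₀, y₁, y₂}) := by
      have h := Order.add_one_le_of_lt (not_le.1 hrS)
      rwa [show ((2 : ℕ∞) + 1) = 3 by norm_num] at h
    have hAB : (3 : ℕ∞) ≤ M.eRk ((K₀ ∩ K₁) ∩ (K₀ ∩ K₂)) :=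
      hrS3.trans (M.eRk_mono (Set.subset_inter hSA hSB))
    have hsub := M.eRk_inter_add_eRk_union_le (K₀ ∩ K₁) (K₀ ∩ K₂)
    have hU3 : M.eRk ((K₀ ∩ K₁) ∪ (K₀ ∩ K₂)) ≤ 3 := by
      have h : (3 : ℕ∞) + M.eRk ((K₀ ∩ K₁) ∪ (K₀ ∩ K₂)) ≤ 3 + 3 :=
        calc (3 : ℕ∞) + M.eRk ((K₀ ∩ K₁) ∪ (K₀ ∩ K₂))
            ≤ M.eRk ((K₀ ∩ K₁) ∩ (K₀ ∩ K₂)) + M.eRk ((K₀ ∩ K₁) ∪ (K₀ ∩ K₂)) := add_le_add hAB le_rfl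
          _ ≤ M.eRk (K₀ ∩ K₁) + M.eRk (K₀ ∩ K₂) := hsub
          _ ≤ 3 + 3 := add_le_add hA3 hB3
      exact (ENat.add_le_add_iff_left (by norm_num : (3 : ℕ∞) ≠ ⊤)).1 h
    have hT3 : M.eRk ((G \ H) \ {y₀}) ≤ 3 :=
      (M.eRk_mono (sdiff_singleton_subset_union_of_three_users hy₁ hy₁H h01 h12 hcov₀ hcov₁ hcov₂)).trans hU3
    have hT5 : ((G \ H) \ {y₀}).ncard ≤ 5 :=
      ncard_le_five_of_eRk_le_three_of_lineFree M hfree hlf (Set.sdiff_subset.trans hGHE) hT3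
    omega

/-- **A `≤ 8`-point side of a `≥ 15`-point set has at most two users** (line-free `e`-free core, rank `≤ 5`): of
any three users two coincide — «an 8-point side at `n = 15` serves at most one point besides `0`». -/
theorem eq_or_eq_or_eq_of_three_users_of_ncard_le_eight_of_lineFree (M : Matroid α) [M.Finite]
    (hfree : ∀ e ∈ M.E, ∃ A ⊆ M.E \ {e}, e ∉ M.closure A ∧ e ∉ M.closure ((M.E \ {e}) \ A))
    (hlf : ∀ T ⊆ M.E, T.ncard = 3 → M.Indep T)
    {G H K₀ K₁ K₂ : Set α} {y₀ y₁ y₂ : α} (hG : G ⊆ M.E) (hH : H ⊆ G)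
    (hK₀ : GClosed M G K₀) (hK₁ : GClosed M G K₁) (hK₂ : GClosed M G K₂)
    (hy₀ : y₀ ∈ G) (hy₁ : y₁ ∈ G) (hy₂ : y₂ ∈ G) (hy₀H : y₀ ∉ H) (hy₁H : y₁ ∉ H) (hy₂H : y₂ ∉ H)
    (hy₀K₀ : y₀ ∉ K₀) (hy₁K₁ : y₁ ∉ K₁) (hy₂K₂ : y₂ ∉ K₂)
    (hcov₀ : G \ {y₀} ⊆ H ∪ K₀) (hcov₁ : G \ {y₁} ⊆ H ∪ K₁) (hcov₂ : G \ {y₂} ⊆ H ∪ K₂)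
    (hr : M.eRk G ≤ 5) (hG15 : 15 ≤ G.ncard) (hH8 : H.ncard ≤ 8) : y₀ = y₁ ∨ y₀ = y₂ ∨ y₁ = y₂ := by
  by_contra hne
  push Not at hne
  have := ncard_le_ncard_add_six_of_three_users_of_lineFree M hfree hlf hG hH hK₀ hK₁ hK₂ hy₀ hy₁ hy₂
    hy₀H hy₁H hy₂H hne.1 hne.2.1 hne.2.2 hy₀K₀ hy₁K₁ hy₂K₂ hcov₀ hcov₁ hcov₂ hr
  omega

end ThmN

end PercRepro
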